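import Literature.NumberTheory.EllipticCurves.QuadraticTwistRank
import Literature.NumberTheory.EllipticCurves.OpenImageMazurAssemblyProofs
import Literature.NumberTheory.EllipticCurves.HeegnerPoints
import HarnessLib

/-!
# Class X11b, route p2: irreducibility of `E[p]` passes to the quadratic twist (cell `b2b-bsdres`, sub-cell `multr1-p2`)

HONEST FRAMING (cell `b2b-bsdres`, run/shared/lean/b2b/bsd-rank1-residual/, verbatim in every
file): the goal of the cell is to DELETE the COMBINATION-SHAPED residual classes of the
Birch–Swinnerton-Dyer formula for ALL analytic-rank `≤ 1` elliptic curves over `ℚ` — "full BSD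
formula for every rank `≤ 1` curve in class `C`" assembled STRICTLY from published theorems — so
that the rank-`≤ 1` remainder becomes exactly the CONSTRUCTION-SHAPED classes, which are TYPED
(missing-input `Prop`s), NOT attempted. This is not "finishing BSD". Sub-cell `multr1-p2` is a
RESEARCH ROUTE on class X11b; no claim beyond the stated class and locus.

THEOREMS ONLY (tree plumbing; item (b) of the transport list of HOME/b2b-bsdres-multr1-p2/REPORT.md
§5). For `E/ℚ` (model `W`) and `c ∈ ℚ^×`: `E^{(c)}[p]` is irreducible iff `E[p]` is. Over
`ℚ̄` the change of variables `u = √c` carries `E^{(c)}` to the completed-square model `E^{(1)}`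
(Silverman, *AEC* X.5 Cor. 5.4; tree `twistUntwist_smul_baseChange`), and the induced bijection of
geometric points `φ` satisfies `σ(φ(P)) = ± φ(σP)` for every `σ ∈ Γ_ℚ` (sign `σ(√c)/√c`; this is
"`E^{(c)}[p] ≅ E[p] ⊗ χ_c`", Silverman X.2 Prop. 2.4 / Exercise 10.16); a `Γ_ℚ`-stable subgroup of
`E[p]` therefore pulls back to a `Γ_ℚ`-stable subgroup of `E^{(c)}[p]` and conversely
(`hasIrreducibleModPGaloisRep_of_addEquiv_upToSign`, a variant of the tree's
`Mazur1978.hasIrreducibleModPGaloisRep_of_addEquiv`), whence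
`hasIrreducibleModPGaloisRep_quadraticTwist_iff` and, for any model `Wd = Cd • W^{(c)}`,
`hasIrreducibleModPGaloisRep_twist_model` (with the tree's `hasIrreducibleModPGaloisRep_smul_iff`).
This discharges the conjunct "`Wd[p]` irreducible" of the twist-transport binder of
`X11b/BDPRouteStatement.lean`.

References: [SilvermanAEC2009] X.2 Prop. 2.4, X.5 Cor. 5.4, Exercise 10.16; [Serre1972] §4.
-/

noncomputable section

open scoped Classical

open WeierstrassCurve Field Literature.NumberTheory.EllipticCurves

universe u

namespace Summit.BirchSwinnertonDyer.Rank1Residual.X11b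

/-- **Irreducibility transported along an additive isomorphism of the `p`-torsion that is
`Γ`-equivariant UP TO SIGN** (`σ(e P) = ± e(σ P)`): if `W'[p]` is irreducible then so is `W[p]`
(the image under `e` of a `Γ`-stable subgroup is `Γ`-stable, subgroups being closed under
negation). Variant of the tree's `Mazur1978.hasIrreducibleModPGaloisRep_of_addEquiv`. [folklore] -/
theorem hasIrreducibleModPGaloisRep_of_addEquiv_upToSign {F : Type u} [Field F]
    {W W' : WeierstrassCurve F} {p : ℕ} (e : geomTorsion W p ≃+ geomTorsion W' p)
    (he : ∀ (σ : absoluteGaloisGroup F) (P : geomTorsion W p),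
      σ • e P = e (σ • P) ∨ σ • e P = -e (σ • P))
    (h : W'.HasIrreducibleModPGaloisRep p) : W.HasIrreducibleModPGaloisRep p := by
  intro H hH
  -- the image of `H` is `Γ`-stable
  have hH' : ∀ (σ : absoluteGaloisGroup F), ∀ Q ∈ H.map e.toAddMonoidHom,
      σ • Q ∈ H.map e.toAddMonoidHom := by
    intro σ Q hQ
    rw [AddSubgroup.mem_map] at hQ ⊢
    obtain ⟨P, hP, rfl⟩ := hQ
    rcases he σ P with h1 | h1
    · refine ⟨σ • P, hH σ P hP, ?_⟩
      change e (σ • P) = σ • e P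
      exact h1.symm
    · refine ⟨-(σ • P), H.neg_mem (hH σ P hP), ?_⟩
      change e (-(σ • P)) = σ • e P
      rw [map_neg]
      exact h1.symm
  rcases h (H.map e.toAddMonoidHom) hH' with hbot | htop
  · left
    rw [eq_bot_iff]
    intro P hP
    have : e P ∈ H.map e.toAddMonoidHom := AddSubgroup.mem_map.mpr ⟨P, hP, rfl⟩
    rw [hbot, AddSubgroup.mem_bot, AddEquiv.map_eq_zero_iff] at this
    rw [AddSubgroup.mem_bot]
    exact this
  · right
    rw [eq_top_iff]
    intro P _
    have : e P ∈ H.map e.toAddMonoidHom := by rw [htop]; exact AddSubgroup.mem_top _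
    obtain ⟨P', hP', hPP'⟩ := AddSubgroup.mem_map.mp this
    have : P' = P := e.injective hPP'
    exact this ▸ hP'

/-- The discriminant of a quadratic number field is not a rational square (`K = ℚ(θ)` with
`θ² = c`, `θ ∉ ℚ`, and `d_K = c q²`). [folklore] -/
theorem not_isSquare_discr_of_finrank_eq_two (K : Type) [Field K] [NumberField K]
    (h2 : Module.finrank ℚ K = 2) : ¬ IsSquare (NumberField.discr K : ℚ) := by
  obtain ⟨θ, c, hθ, hc⟩ := Literature.NumberTheory.QuadraticFields.Quadratic.exists_sq_eq_algebraMap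
    (F := ℚ) (K := K) h2
  obtain ⟨q, hq, hdq⟩ := NumberField.exists_discr_eq_mul_sq h2 hθ hc
  rintro ⟨r, hr⟩
  -- `c = (r/q)²`, so `θ = ± r/q ∈ ℚ`
  have hcsq : (c : ℚ) = (r / q) * (r / q) := by
    have : (NumberField.discr K : ℚ) = c * q ^ 2 := by exact_mod_cast hdq
    rw [hr] at this
    field_simp
    linear_combination -this
  have hθ2 : θ ^ 2 = (algebraMap ℚ K (r / q)) ^ 2 := by rw [hc, hcsq, sq, map_mul]
  rcases sq_eq_sq_iff_eq_or_eq_neg.mp hθ2 with h' | h'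
  · exact hθ ⟨r / q, h'.symm⟩
  · exact hθ ⟨-(r / q), by rw [map_neg]; exact h'.symm⟩

/-- **`E^{(c)}[p]` irreducible ⟸ `E^{(1)}[p]` irreducible** for `c ∈ ℚ^×` not a square: over
`ℚ̄ ∋ θ = √c` the substitution `u = θ` identifies the points of `E^{(c)}` and of the
completed-square model `E^{(1)}` (`twistUntwist_smul_baseChange`), `(x, y) ↦ (θ⁻²x, θ⁻³y)`, and for
`σ ∈ Γ_ℚ` with `σθ = ±θ` this bijection satisfies `σ(φ P) = ±φ(σ P)` (`-(x,y) = (x,-y)` on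
`E^{(1)}`); apply `hasIrreducibleModPGaloisRep_of_addEquiv_upToSign`.
[cite: SilvermanAEC2009, X.5 Cor. 5.4 and X.2 Prop. 2.4] -/
theorem hasIrreducibleModPGaloisRep_quadraticTwist_of_one (W : WeierstrassCurve ℚ) {c : ℚ}
    (hcsq : ¬ IsSquare c) (p : ℕ)
    (h : (W.quadraticTwist 1).HasIrreducibleModPGaloisRep p) :
    (W.quadraticTwist c).HasIrreducibleModPGaloisRep p := by
  -- a square root of `c` in `ℚ̄`, not in `ℚ`
  obtain ⟨θ, hθθ⟩ := IsAlgClosed.exists_eq_mul_self (algebraMap ℚ (AlgebraicClosure ℚ) c)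
  have hc : θ ^ 2 = algebraMap ℚ (AlgebraicClosure ℚ) c := by rw [sq]; exact hθθ.symm
  have hθ : θ ∉ Set.range (algebraMap ℚ (AlgebraicClosure ℚ)) := by
    rintro ⟨r, hr⟩
    apply hcsq
    refine ⟨r, ?_⟩
    have : algebraMap ℚ (AlgebraicClosure ℚ) (r * r) = algebraMap ℚ (AlgebraicClosure ℚ) c := by
      rw [map_mul, hr, ← hθθ]
    exact ((algebraMap ℚ (AlgebraicClosure ℚ)).injective this).symm
  have hθ0 : θ ≠ 0 := Literature.NumberTheory.QuadraticFields.Quadratic.ne_zero_of_not_mem_range hθ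
  haveI : NeZero (2 : ℚ) := ⟨two_ne_zero⟩
  -- the bijection of geometric points `E^{(c)}(ℚ̄) ≃+ E^{(1)}(ℚ̄)`
  let e₀ : ((W.quadraticTwist c).baseChange (AlgebraicClosure ℚ)).toAffine.Point ≃+
      ((W.quadraticTwist 1).baseChange (AlgebraicClosure ℚ)).toAffine.Point :=
    (VariableChange.pointEquiv ((W.quadraticTwist c).baseChange (AlgebraicClosure ℚ))
      (twistUntwist hθ)).trans (Affine.Point.congrEquiv (twistUntwist_smul_baseChange W hθ hc))
  have key : ∀ {x y : AlgebraicClosure ℚ}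
      (h' : ((W.quadraticTwist c).baseChange (AlgebraicClosure ℚ)).toAffine.Nonsingular x y),
      e₀ (.some x y h') = Affine.Point.congrEquiv (twistUntwist_smul_baseChange W hθ hc)
        (.some ((twistUntwist hθ).toX x) ((twistUntwist hθ).toY x y)
          ((VariableChange.nonsingular_iff _ (twistUntwist hθ) x y).mpr h')) := by
    intro x y h'
    show Affine.Point.congrEquiv _ (VariableChange.pointEquiv _ _ (.some x y h')) = _
    rw [VariableChange.pointEquiv_some]
  -- its behaviour under `Aut(ℚ̄/ℚ)`: equivariant up to the sign `τθ/θ`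
  have hsign : ∀ (τ : AlgebraicClosure ℚ ≃ₐ[ℚ] AlgebraicClosure ℚ)
      (P : ((W.quadraticTwist c).baseChange (AlgebraicClosure ℚ)).toAffine.Point),
      Affine.Point.map (τ : AlgebraicClosure ℚ →ₐ[ℚ] AlgebraicClosure ℚ) (e₀ P) =
          e₀ (Affine.Point.map (τ : AlgebraicClosure ℚ →ₐ[ℚ] AlgebraicClosure ℚ) P) ∨
        Affine.Point.map (τ : AlgebraicClosure ℚ →ₐ[ℚ] AlgebraicClosure ℚ) (e₀ P) =
          -e₀ (Affine.Point.map (τ : AlgebraicClosure ℚ →ₐ[ℚ] AlgebraicClosure ℚ) P) := by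
    intro τ P
    have hτθ : τ θ = θ ∨ τ θ = -θ := by
      apply mul_self_eq_mul_self_iff.mp
      rw [← sq, ← sq, ← map_pow, hc, AlgEquiv.commutes]
    rcases P with _ | ⟨x, y, hP⟩
    · left
      rw [← Affine.Point.zero_def, map_zero, map_zero, map_zero, map_zero]
    · rw [Affine.Point.map_some, key, key, Affine.Point.congrEquiv_some, Affine.Point.congrEquiv_some,
        Affine.Point.map_some, Affine.Point.neg_some]
      simp only [WeierstrassCurve.QuadraticDescent.negY_quadraticTwist_one_baseChange,
        VariableChange.toX_def, VariableChange.toY_def,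
        twistUntwist, sub_zero, zero_mul, inv_pow, Units.val_inv_eq_inv_val, Units.val_mk0, map_mul,
        map_inv₀, map_pow, Affine.Point.some.injEq]
      rcases hτθ with h1 | h1
      · have h1' : (τ : AlgebraicClosure ℚ →ₐ[ℚ] AlgebraicClosure ℚ) θ = θ := h1
        left; rw [h1']; exact ⟨rfl, rfl⟩
      · have h1' : (τ : AlgebraicClosure ℚ →ₐ[ℚ] AlgebraicClosure ℚ) θ = -θ := h1
        right; rw [h1']
        refine ⟨?_, ?_⟩
        · rw [Even.neg_pow (by decide : Even 2)]
        · rw [Odd.neg_pow (by decide : Odd 3), inv_neg, neg_mul]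
  -- restriction to the `p`-torsion (as in `Mazur1978.hasIrreducibleModPGaloisRep_smul_iff`)
  let e : geomPoints (W.quadraticTwist c) ≃+ geomPoints (W.quadraticTwist 1) := e₀
  have hsmul : ∀ (σ : absoluteGaloisGroup ℚ) (P : geomPoints (W.quadraticTwist c)),
      σ • e P = e (σ • P) ∨ σ • e P = -e (σ • P) := fun σ P ↦
    hsign (absoluteGaloisGroup.toAlgEquiv ℚ σ) P
  have htor : ∀ {P : geomPoints (W.quadraticTwist c)},
      P ∈ geomTorsion (W.quadraticTwist c) p ↔ e P ∈ geomTorsion (W.quadraticTwist 1) p := by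
    intro P
    rw [geomTorsion, geomTorsion, AddSubgroup.torsionBy.nsmul_iff, AddSubgroup.torsionBy.nsmul_iff,
      ← map_nsmul, AddEquiv.map_eq_zero_iff]
  let eₚ : geomTorsion (W.quadraticTwist c) p ≃+ geomTorsion (W.quadraticTwist 1) p :=
    { toFun := fun P ↦ ⟨e P, htor.mp P.2⟩
      invFun := fun Q ↦ ⟨e.symm Q, by rw [htor, e.apply_symm_apply]; exact Q.2⟩
      left_inv := fun P ↦ Subtype.ext (e.symm_apply_apply _)
      right_inv := fun Q ↦ Subtype.ext (e.apply_symm_apply _)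
      map_add' := fun P Q ↦ Subtype.ext (by
        change e ((P : geomPoints (W.quadraticTwist c)) + Q) = e P + e Q
        exact map_add e _ _) }
  have heₚ : ∀ (σ : absoluteGaloisGroup ℚ) (P : geomTorsion (W.quadraticTwist c) p),
      σ • eₚ P = eₚ (σ • P) ∨ σ • eₚ P = -eₚ (σ • P) := by
    intro σ P
    rcases hsmul σ (P : geomPoints (W.quadraticTwist c)) with h1 | h1
    · left
      exact Subtype.ext (by
        change σ • e (P : geomPoints (W.quadraticTwist c)) =
          e ((σ • P : geomTorsion (W.quadraticTwist c) p) : geomPoints (W.quadraticTwist c))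
        rw [AddSubgroup.torsionBy.coe_smul, h1])
    · right
      exact Subtype.ext (by
        change σ • e (P : geomPoints (W.quadraticTwist c)) =
          -e ((σ • P : geomTorsion (W.quadraticTwist c) p) : geomPoints (W.quadraticTwist c))
        rw [AddSubgroup.torsionBy.coe_smul, h1])
  exact hasIrreducibleModPGaloisRep_of_addEquiv_upToSign eₚ heₚ h

/-- **`E[p]` irreducible ⟹ `E^{(c)}[p]` irreducible** (`c ∈ ℚ^×` not a square): `E ≅ E^{(1)}`
over `ℚ` by completing the square (`exists_variableChange_quadraticTwist_one`,
`hasIrreducibleModPGaloisRep_smul_iff`), then `hasIrreducibleModPGaloisRep_quadraticTwist_of_one`.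
[cite: SilvermanAEC2009, X.5 Cor. 5.4] -/
theorem hasIrreducibleModPGaloisRep_quadraticTwist (W : WeierstrassCurve ℚ) {c : ℚ}
    (hcsq : ¬ IsSquare c) (p : ℕ) (h : W.HasIrreducibleModPGaloisRep p) :
    (W.quadraticTwist c).HasIrreducibleModPGaloisRep p := by
  haveI : NeZero (2 : ℚ) := ⟨two_ne_zero⟩
  obtain ⟨C, hC⟩ := W.exists_variableChange_quadraticTwist_one
  have h1 : (W.quadraticTwist 1).HasIrreducibleModPGaloisRep p := by
    rw [← hC, Mazur1978.hasIrreducibleModPGaloisRep_smul_iff]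
    exact h
  exact hasIrreducibleModPGaloisRep_quadraticTwist_of_one W hcsq p h1

/-- **Irreducibility of `E[p]` passes to every model of the twist by a quadratic field's
discriminant**: for a quadratic number field `K` (so `d_K` is not a rational square) and any change
of variables `Cd` over `ℚ`, if `E[p]` is irreducible then so is `(Cd • W^{(d_K)})[p]`. This
discharges the conjunct "`Wd[p]` irreducible" of the twist-transport binder of
`X11b/BDPRouteStatement.lean` (item (b) of HOME/b2b-bsdres-multr1-p2/REPORT.md §5).
[cite: SilvermanAEC2009, X.5 Cor. 5.4 and Exercise 10.16] -/
theorem hasIrreducibleModPGaloisRep_twist_model (W : WeierstrassCurve ℚ) (p : ℕ) (K : Type)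
    [Field K] [NumberField K] (h2 : Module.finrank ℚ K = 2) (h : W.HasIrreducibleModPGaloisRep p)
    {Wd : WeierstrassCurve ℚ} (Cd : VariableChange ℚ)
    (hWd : Cd • W.quadraticTwist (NumberField.discr K : ℚ) = Wd) :
    Wd.HasIrreducibleModPGaloisRep p := by
  rw [← hWd, Mazur1978.hasIrreducibleModPGaloisRep_smul_iff]
  exact hasIrreducibleModPGaloisRep_quadraticTwist W (not_isSquare_discr_of_finrank_eq_two K h2) p h

end Summit.BirchSwinnertonDyer.Rank1Residual.X11b

end
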